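import Literature.AnabelianGeometry.EtaleTheta.Discharge.Sec3Thm37OfInputsCnst
import Literature.AnabelianGeometry.EtaleTheta.Discharge.Sec3Thm37RatStdOfCosetCnst
import Literature.AnabelianGeometry.EtaleTheta.Discharge.Sec3ConstantLineOfRlfZ
import HarnessLib

/-!
# [EtTh] Theorem 3.7 (i)–(iv) — END KNIT, third form: `Λ = ℤ` data with the PRINTED constant-field category
# `D^cnst = 𝓑(G_K)⁰` — the residual list is a list of properties of the Def. 3.3 (iii) data (proof-only)

S. Mochizuki, *The étale theta function and its Frobenioid-theoretic manifestations*, Publ. RIMS **45**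
(2009) [EtTh], Thm. 3.7, PDF pp. 79–80; the setting p. 72 (printed 298) "`D^cnst := B(Spec K)⁰`"
[cite: MochizukiEtTh2009, Thm 3.7 p.79].  Sequel of `Sec3Thm37OfInputs.lean` (p429227) and
`Sec3Thm37OfInputsCnst.lean` (p429404) (abc-iut cell, layer L2, node EtTh:Thm3.7 «END KNIT», abc-iut-L2-lead gen 3
R129; seat abc-iut-w5-d164 gen 3).  For the constructed Def. 3.6 (i) data of monoid type `ℤ` (`ofRlfZ dm hpf`, the
data §4–§5 use) and a constant-field functor valued in the tree's coset category `CosetCat G` of a COMPACT group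
(`D^cnst = 𝓑(G_K)⁰` as printed), the two remaining (ii)-inputs of the second form are THEOREMS:
`hLine` ⟸ `hcyc` ("the divisors of the constants `F₀(Y) ≅ L^×` are the integer powers of one log-divisor" — print:
`div₀(c) = v_L(c)·div(ϖ_L)`, Prop. 3.4 (ii); abc-iut-w4-d008 `RealifiedDivisorMonoids.ofRlfZ_line`), `hfin` ⟸
`Aut(L/K)` finite (abc-iut-w5-d250 `CosetCat.isOfFinOrder_aut`, via `thm37_ii_ratStd_treeCatVocab_of_cosetCnst`).
So **`thm37_ofRlfZ_of_inputs_of_cosetCnst`**: [EtTh] Thm. 3.7 (i)–(iv) with residual binders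
{`hBmon`, `hP34`, `hD`, `hnd`, `hrat`, `h34 : dm.Prop34`, `h₀ : dm.Prop34Cnst₀ cnst`, `hcyc`} — every item a property
of the Def. 3.3 (iii) data `(Φ₀, B₀, div₀, F₀)` of actual tempered coverings (Prop. 3.4 and its constant-field
clauses) or a print hypothesis (`hD`, `hnd`, `hrat`) or [FrdI] Thm. 5.2's preamble (`hBmon`).  No definitions;
nothing here bears on [IUTchIII] Cor. 3.12.
-/

namespace Literature.AnabelianGeometry.EtaleTheta

open CategoryTheory Opposite Literature.AlgebraicGeometry.Frobenioids Literature.AnabelianGeometry.SemiGraphs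

namespace TemperedFrobenioid

universe u₀ v₀ u₁ u v w uK

variable {D₀ : Type u₀} [Category.{v₀} D₀] {dm : DivisorMonoids.{u₀, v₀, w} D₀}
  {hpf : ∀ Y : D₀ᵒᵖ, IsPerfFactorial (dm.Φ₀.obj Y)} {V : FrdIMonoidStub.{w}} {V₀ : FrdICatStub.{u₀, v₀, w} D₀}
  {D : Type u} [Category.{v} D] {IsRational IsStrictlyRational : (Dᵒᵖ ⥤ CommMonCat.{w}) → Prop}
  (C₀ : TemperedFrobenioid (RealifiedDivisorMonoids.ofRlfZ dm hpf) D (treeCatVocab D IsRational IsStrictlyRational))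
  {GK : Type u₁} [Group GK] [TopologicalSpace GK] [SeparatelyContinuousMul GK] [CompactSpace GK]
  {cnst : D₀ ⥤ CosetCat GK} (p : ℕ) [Fact p.Prime]

/-- **[EtTh] Theorem 3.7 (i)–(iv) for `Λ = ℤ` data with `D^cnst = 𝓑(G)⁰` (`G` compact, e.g. `G_K`)** — residual
binders {`hBmon`, `hP34`, `hD`, `hnd`, `hrat`, `h34`, `h₀`, `hcyc`}: (i) unit-profinite / isotropic / model /
birationally Frobenius-normalized / sub-quasi-Frobenius-trivial / not group-like; (ii) standard ∧ rationally standard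
(THE [FrdI] Def. 4.5 parameters); (iii) both clauses over `(D → D₀) ⋙ cnst`; (iv). [cite: MochizukiEtTh2009, Thm 3.7 p.79] -/
theorem thm37_ofRlfZ_of_inputs_of_cosetCnst (hBmon : IsMonoidOn C₀.ratFnFunctor)
    (hP34 : ∀ A : Dᵒᵖ, ∃ L : PadicFrd.PadicFld.{uK} p, L.IsPadicLocal ∧
      Nonempty ((((RealifiedDivisorMonoids.ofRlfZ dm hpf).divΛ (C₀.baseOp A)).comp
        (Units.coeHom ((RealifiedDivisorMonoids.ofRlfZ dm hpf).BΛ.obj (C₀.baseOp A)))).ker ≃*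
        PadicFrd.unitSubgroup L.K))
    (hD : IsOfFSMFFType D) (hnd : IsNonDilatingOn C₀.divisorMonoid)
    (hrat : ∀ X : C₀.category,
      PreFrobenioidData.IsRational
        (PreFrobenioid.biratData (C₀.isFrobenioid_treeCatVocab_of_isMonoidOn hBmon)
          (PreFrobenioid.hasBiratSquares_of_isFrobenioid (C₀.isFrobenioid_treeCatVocab_of_isMonoidOn hBmon)))
        (S := PreFrobenioidData.ofFunctor C₀.divisorMonoid C₀.toElem) (fun a 𝔭 => PrimarySupp a 𝔭) X)
    (h34 : dm.Prop34 V V₀) (h₀ : dm.Prop34Cnst₀ cnst)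
    (hcyc : ∀ Y : D₀ᵒᵖ, ∃ d : dm.Φ₀.obj Y, ∀ b ∈ dm.F₀ Y, ∃ n : ℤ,
      dm.div₀ Y b = Algebra.GrothendieckGroup.of d ^ n) :
    (PreFrobenioid.IsOfUnitProfiniteType C₀.toElem ∧
      PreFrobenioid.IsOfIsotropicType C₀.toElem ∧
      PreFrobenioid.IsOfModelType C₀.toElem (C₀.isFrobenioid_treeCatVocab_of_isMonoidOn hBmon)
        (PreFrobenioid.hasBiratSquares_of_isFrobenioid (C₀.isFrobenioid_treeCatVocab_of_isMonoidOn hBmon)) ∧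
      PreFrobenioidData.IsOfBiratFrobeniusNormalizedType
        (PreFrobenioid.biratData (C₀.isFrobenioid_treeCatVocab_of_isMonoidOn hBmon)
          (PreFrobenioid.hasBiratSquares_of_isFrobenioid (C₀.isFrobenioid_treeCatVocab_of_isMonoidOn hBmon))) ∧
      PreFrobenioid.IsOfType (PreFrobenioid.IsSubQuasiFrobeniusTrivial C₀.toElem) ∧
      ¬ PreFrobenioid.IsOfType (PreFrobenioid.IsGroupLikeObj C₀.toElem)) ∧
    ((ModelFrobenioid.data C₀.divisorMonoid C₀.ratFnFunctor C₀.divBNatTrans).IsOfStandardType ∧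
      (PreFrobenioidData.ofFunctor C₀.divisorMonoid C₀.toElem).IsOfRationallyStandardType
        (PreFrobenioid.rsParams (C₀.isFrobenioid_treeCatVocab_of_isMonoidOn hBmon) fun a 𝔭 => PrimarySupp a 𝔭)) ∧
    ((∀ A : C₀.category,
        FrobenioidFacade.AutActionFactorsThrough (C₀.base ⋙ cnst) C₀.toElem A) ∧
      (∀ A : C₀.category, FrobenioidFacade.AutActionFaithful (C₀.base ⋙ cnst) C₀.toElem A)) ∧
    C₀.Thm37_iv :=
  C₀.thm37_ofRlfZ_of_inputs_of_cnst p hBmon hP34 hD hnd hrat h34 h₀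
    (RealifiedDivisorMonoids.ofRlfZ_line dm hpf hcyc) fun Z φ => CosetCat.isOfFinOrder_aut Z φ

end TemperedFrobenioid

end Literature.AnabelianGeometry.EtaleTheta
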